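import Mathlib
import HarnessLib
import HarnessLib.Audit
import Summits.AtomisticToContinuum.Statement
import Literature.MathematicalPhysics.StatisticalMechanics.LennardJonesClusters
import Literature.MathematicalPhysics.StatisticalMechanics.HaggStacking
import Literature.MathematicalPhysics.StatisticalMechanics.BarlowStacking
import Literature.MathematicalPhysics.StatisticalMechanics.BarlowStackingEnergy
import Summits.AtomisticToContinuum.Crystallization.Theorems.PricedLinkCensusStackingHingeLjRegistryDomination
import Summits.AtomisticToContinuum.Crystallization.Theorems.PricedLinkCensusChargedPeriodicIsOptimal
import Summits.AtomisticToContinuum.Crystallization.Theorems.PalmUnimodularRigidityChargedPatternCrystallizes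

/-!
Route: GscLoopSurgery

CLOSED (retired) 2026-08-15T13:42:57Z by operator:999:1257524 — reason: not-a-thesis: assembly does not conclude the sub-problem Statement — note: D-0027 §2.1 audit (human 2026-08-15: routes that do not decide the summit are removed): the assembly concludes `Literature.MathematicalPhysics.StatisticalMechanics.Crystallization`, not the sub-problem statement; a NEW conforming route may be opened from the same idea (generated `closes : … → _root_. The file is kept as the record of this route; refuted decls are indexed as negative knowledge (`ledger negatives`).

# Route GscLoopSurgery — dislocation-loop surgery on infinite-volume ground states (card
gsc-dislocation-loop-surgery, ideator-6)

It suffices to show X := GroundStatesChargePeriodic (the finite-N hinge shared with route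
BenjaminiSchrammGroundStates, item 2911):
for every sequence of Lennard-Jones ground states x^N in ℝ³ there is ONE periodic configuration Q
such that for all R, ε > 0 a
positive fraction ρ(R,ε) of the particles, for infinitely many N, have their R-neighbourhood
ε-matched both ways with an isometric
copy of Q based at a point of Q.
Lean (X, verbatim 2911): `∀ x : (N : ℕ) → (Fin N → EuclideanSpace ℝ (Fin 3)), (∀ N, IsGroundState
lennardJones (x N)) → ∃ Q :
PeriodicConfiguration 3, ∀ R ε : ℝ, 0 < R → 0 < ε → ∃ ρ : ℝ, 0 < ρ ∧ ∃ᶠ N : ℕ in Filter.atTop, ρ *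
(N : ℝ) ≤ (Nat.card {i : Fin N //
∃ A : E →ₗᵢ[ℝ] E, ∃ q ∈ Q.points, (∀ s ∈ Q.points, dist s q ≤ R → ∃ j, dist (x N j) (x N i + A (s -
q)) ≤ ε) ∧ (∀ j, dist (x N j)
(x N i) ≤ R → ∃ s ∈ Q.points, dist (x N j) (x N i + A (s - q)) ≤ ε)} : ℝ)` (constants fully
qualified in the file).

HOW X IS REACHED (this route's mechanism, at INFINITE volume, on individual configurations): let 𝔏
be the class of local
limits X ⊆ ℝ³ of translated ground-state sequences (two-way matching on every ball; typed inline) —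
zero pressure is built in,
and every X ∈ 𝔏 is a hard-core canonical ground state configuration (GSC: no particle-conserving
compact rearrangement by
distinct points lowers the energy; support LocalLimitStable, the Radin/BRS existence argument).
Three statements about
r₀-dense members of 𝔏:
(S) LayeredWindows — at every scale R some R-window of X is (1/1000)-matched both ways with an
isometric copy of a uniform
Barlow stacking barlowStacking a h s, (a,h) in the box B = {0.94 ≤ a ≤ 1, 0.78a ≤ h ≤ 0.85a}, s ANY
Hägg word;
(L) TwinLoopLemma — if X is GLOBALLY (1/1000)-matched with barlowStacking a h s and the registry
couplings at (a,h) satisfy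
Hägg domination (J₂ < 0, Σ_{k≥3}(k−1)|J_k| ≤ |J₂|/2), then the word s has AT MOST ONE wall {m :
s(m+1) = s(m)}: two walls at
distance D are annihilated by slipping every other layer of the slab between them by a Shockley
partial inside a disc of radius
L (gain ≥ 2(|J₂| − Σ(k−1)|J_k|)·πL²/cell against cost O(D·L) for the partial-loop dipoles) — the
metallurgist's critical loop
radius as a variational TEST of an infinite-volume ground state (Dobrushin's two-wall slab argument
for Ising GSCs, with
dislocation loops as the cylinder);
(P) HcpLiouvilleRigidity — a member of 𝔏 globally (1/1000)-matched with the exact hcpStacking a h IS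
a translate of it
(atomistic Liouville theorem: bounded locally-stable perturbations of the perfect crystal are
trivial).
With the certified domination LjRegistryDomination (shared 3063) and the cohesion input NoFoam
(shared 2912), compactness of
𝔏 under isometries, translations and local limits turns (S)+(L)+(P) into: every r₀-dense X ∈ 𝔏 has
ε-perfect hcp R-windows
within distance L(R,ε) of every point; transplanting to finite N around NoFoam-deep particles and
pigeonholing the window
parameters over B gives X with Q = hcpPeriodicConfiguration a∞ h∞ (support GscHingeGlue:
LocalLimitStable → S → L → P →
LjRegistryDomination → NoFoam → X).

## Assembly
X → ChargedPeriodicIsOptimal (2913, surgery-attainment: the charged Q is a least element of e over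
periodic configurations)
→ ChargedPatternCrystallizes (2916: X + LennardJonesMinimalDistance ⇒ IsCrystallizing lennardJones
3) → CrysEnergyLimit
(0626: E(N)/N → ⨅_Q e(Q)) → Literature.MathematicalPhysics.StatisticalMechanics.Crystallization (=
the sub-problem constant
`Crystallization`, an abbrev). Pure logic plus the PROVED facts LennardJonesGroundStatesExist_holds
/
LennardJonesMinimalDistance_holds and IsLeast.csInf_eq — checked in the planner's Sketch.lean
(`assembly_provable`).

Rationale: WHY THIS LINE. The finite-N routes (CrystalLocalRigidity, CrystalKissingRigidity,
PoissonBesselStacking's positional half) must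
count defects against an N^(2/3) surface budget; the sister infinite-volume route
BenjaminiSchrammGroundStates passes to
stationary MEASURES. This route passes to infinite volume on individual CONFIGURATIONS: local limits
of translated ground states
are canonical ground state configurations in the sense of Radin/Sütő (Suto2011 §7 Def. 4;
BellissardRadinShlosman2010;
GardnerRadin1979 for d = 1), i.e. exactly stable under every particle-conserving compact
rearrangement, and exact stability can
be TESTED with the mesoscopic trial fields of dislocation theory: a Shockley partial loop of radius
L converts the stacking of a
disc at cost O(L log L) (Frank/Hirth–Lothe nucleation; CaiNix2016 §11.1.12 "unfaulting": fault
energy ∝ L² vs loop energy) —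
so two twin walls, two parallel grain boundaries, two vacancies or a foam are never locally stable,
while ONE wall is
(Dobrushin1973's slab argument for Ising ground state configurations, transplanted with loops as the
cylinder mantle).
Imported areas: dislocation theory of close-packed metals (partial loops, stacking-fault/twin
energies), infinite-volume
ground-state-configuration theory (Radin, BRS, Sütő), atomistic far-field/defect analysis
(HudsonOrtner2014,
EhrlacherOrtnerShapeev2016) for the Liouville crux, and the rigorous dislocation-loop Peierls
estimates of GiulianiTheil2021 as
the nearest technique. Only UPPER bounds on explicit trial fields and |J₂| ≠ 0 with domination are
used for (L); the sign of J₂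
enters only through the shared certified item 3063.

RANKED CRUXES. #2 LayeredWindows (hardest; the LJ local physics at infinite volume: Barlow layering
off sparse defects, i.e.
N1 + anti-foam of the card, stated as existence of (1/1000)-layered R-windows in every r₀-dense
local limit). #3 TwinLoopLemma
(the card's new mechanism; ≤ 1 wall). #4 HcpLiouvilleRigidity (bounded locally-stable perturbations
of hcp are translates).
#5 LjRegistryDomination (shared 3063, certified numerics: the unproved fact the mechanism needs —
filed as a crux so it is
staffed first). #6 NoFoam (shared 2912, cohesion: the one finite-N input). Target #0 =
GroundStatesChargePeriodic (2911).
Support: LocalLimitStable (rank 8, enabling lemma, prove early), GscHingeGlue (rank 9, soft: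
compactness/diagonal/pigeonhole),
ChargedPeriodicIsOptimal (2913), ChargedPatternCrystallizes (2916), CrysEnergyLimit (0626, conjunct
(i) limit identification,
imported exactly as in the sister routes).

TWO-LAYER PLAN. Now: the five cruxes + target + assembly + glue. Foreseen split 1 (when
TwinLoopLemma or LocalLimitStable
closes): LayeredWindows ⇐ LocalBarlow (r₀-dense members of 𝔏 are locally (1/1000)-Barlow off a
closed set meeting o(L³) unit
cubes of B_L: soft twelve-coordination at infinite volume, cf. 0750/0758) → AntiFoam (the defect set
meets O(L²) cubes: grain
coarsening by recrystallising a ball, with a void pocket absorbing the density deficit) →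
LayeredWindows. Foreseen split 2 (when
NoFoam closes): a density upgrade ZeroDefectDensity (defective points have density 0 in every
r₀-dense X ∈ 𝔏) which, through
the unimodular averaging of the sister route, would also discharge CrysEnergyLimit (0626); not
filed. BoundedCores (disclinated
icosahedral cores have radius ≤ R₀ ~ γ_GB/(μω²)) rides inside LocalBarlow's proof, not an item.

KILL CRITERIA. (i) LjRegistryDomination refuted (J₂ ≥ 0 or domination fails on B) ⇒ TwinLoopLemma's
hypothesis is empty on
the physical box: close unless a P-agnostic restatement (walls := sign changes for J₂ > 0) survives.
(ii) An explicit r₀-dense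
local limit of LJ ground states that is not layered at some scale (amorphous/polytetrahedral GSC)
refutes LayeredWindows and
every sphere-packing-heritage route with it. (iii) A bounded non-trivial locally stable perturbation
of hcp refutes
HcpLiouvilleRigidity ⇒ restate with "ε-close on large balls for every ε" (weaker, still sufficient
for the glue). (iv) NoFoam
refuted ⇒ the GSC statements stay true but the assembly loses its finite-N anchor ⇒ pivot to the
Palm-side formulation (card
palm-unimodular-zero-pressure-limit) or close superseded. Refutation of 0627/0626 kills conjunct (i)
for every route.

NOT DECOMPOSED YET. The elastic bookkeeping constants of the loop (core energy, dipole interaction,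
the ⟨residual force, δ⟩
and O(V''η₀²DL²) terms — refuter R4's analysis), equilibrium smoothness of δ, rotations/re-centring
lattice translations in the
glue, the Hausdorff-compactness and diagonal lemmas for 𝔏, the pigeonhole over B-cells; definition
requests (none filed: 𝔏,
the hard-core GSC predicate and two-way matching are typed INLINE and can be named later by
set-signature:
Summits/AtomisticToContinuum/Crystallization/Theorems: IsLocalLimitOfGroundStates, IsHardCoreGSC,
TwoWayNear).

NUMBERS. a* ≈ 0.9712 (fcc/hcp LJ nearest-neighbour distance with pair minimum at 1:
(2A₁₂/A₆)^(1/6)/2^(1/6)), h* = a*√(2/3) ≈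
0.793 ∈ B; J₂ ≈ −7.25e−5, |J₂|/Σ(k−1)|J_k| ≈ 287–428 (PoissonBessel numerics, uncertified); partial
Burgers vector a/√3 ≈ 0.56
≫ 2η₀ = 0.002; wall relaxation displacements ~ (∂_hJ)/K ~ 1e−5 ≪ η₀; surgery gain 2|J₂|π/cell ≈
4.5e−4 per unit disc area vs
second-order error ≈ 3V''(a*)η₀²·D ≈ 2e−5·D ⇒ unconditional for D ≲ 20, smoothness of δ needed
beyond.

CHEAPEST FALSIFIER. (1) The certified computation 3063 (shared). (2) A toy check of TwinLoopLemma's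
energy balance: relax a
periodic LJ supercell with two twin walls at distance D and a slipped disc of radius L between them
(kit job; E(L) should turn
negative at L* ≈ C·D/|J₂|-scale ~ 10³–10⁴ a — large but finite). (3) Junk audit done by hand: ∅ ∈ 𝔏
but fails r₀-density and
global matching; coincident competitors are excluded by injectivity + disjointness (the reason
Suto.IsGSC is NOT used: with
lennardJones 0 = 0 it is false for every configuration of negative energy); compressed crystals are
GSCs but not in 𝔏.

Novelty: Searches (2026-08-15): lit search --hybrid "ground state configurations infinite volume local
stability Lennard-Jones crystal defects dislocation" (15: Bétermin–Šamaj–Travěnec 2107.14020 lattice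
energies; Cai–Nix, Allnatt–Lidiard, Kleinert — textbooks); lit search --hybrid "Shockley partial
dislocation loop stacking fault twin boundary critical radius nucleation" (10 books; CaiNix2016
§11.1.12 read, pp. 372–373: unfaulting by a Shockley loop, fault energy ∝ L²); crossref "Bellissard
Radin Shlosman characterization of ground states" (doi:10.1088/1751-8113/43/30/305001,
RadinSchulman1983, Radin 1984/1986); crossref "rigorous stacking fault energy ground state
Lennard-Jones twin boundaries infinite crystal" (only GardnerRadin1979 d = 1 is rigorous; rest
metallurgy); crossref EOS boundary conditions (doi:10.1007/s00205-016-1019-6); lit read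
arxiv:1004.5260 §7 (Suto2011 Def. 4 GSC, Conjecture 1 finite→infinite); openalex/arxiv HTTP 429,
zbMATH 0, galaxy --star all queued > 90 s twice (0 rows); lit frontier/bridges AtomisticToContinuum
(kinetic/BEC dominated, nothing on GSC surgery); plus the refuter novelty audit on the card (R4 +
second opinion, 2026-08-15T10:53Z: NEW-COMBINATION).
Nearest prior art: Dobrushin1973 (two parallel Ising walls removed by flipping a cylinder: the
template of TwinLoopLemma); BellissardRadinShlosman2010 / Radin1987 / Suto2011 (existence and
stationarity of ground state configurations — never combined with mesoscopic elastic test fields);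
Frank–Hirth–Lot  [refs: 10.1088/1751-8113/43/30/305001, 10.1007/s00205-016-1019-6, 1004.5260, doi:10.1088/1751-8113/43/30/305001, doi:10.1007/s00205-016-1019-6, arxiv:1004.5260, CaiNix2016, RadinSchulman1983, GardnerRadin1979, Suto2011, Dobrushin1973, BellissardRadinShlosman2010, Radin1987, HudsonOrtner2014, EhrlacherOrtnerShapeev2016, GiulianiTheil2021]

Barriers (technique_class: gsc-surgery, dislocation-loop-test-fields, local-limits): technique_class: gsc-surgery, dislocation-loop-test-fields, local-limits
- Literature.Barriers.AtomisticToContinuum.SutoDegenerateGroundStates: not met — LJ is not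
Fourier-positive/band-limited, and the class 𝔏 (local limits of FREE finite ground states) is at
zero pressure, where by the barrier's scope caveat (d) no degenerate member competes; the route
never argues potential-generically: LayeredWindows/TwinLoopLemma use the LJ registry couplings
J_k(a,h) and the hard core explicitly. Lesson drawn: canonical GSCs include compressed crystals,
hence provenance (𝔏) is part of every hypothesis.
- Literature.Barriers.AtomisticToContinuum.KissingTwelveDegeneracy and
Literature.Barriers.AtomisticToContinuum.ShortRangeStackingBlindness: evaded — stacking selection
enters only through |J₂| ≠ 0 with domination (tail beyond √(8/3), shared certified item 3063);
contact counting is never asked to select a stacking: TwinLoopLemma kills walls PAIRWISE by an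
energy comparison at range ≥ 2 layers.
- Literature.Barriers.AtomisticToContinuum.Hubbard1978_mostHomogeneous: applies to any "periodic
ansatz" for the Hägg word; evaded because no periodicity of s is assumed — an aperiodic (Sturmian)
optimal word would have walls at bounded gaps, and any two of them are removed by one surgery; the
barrier bites only if domination FAILS (then 3063 is refuted and kill criterion (i) fires).
- Literature.Barriers.AtomisticToContinuum.FlexibleKissingArrangements and
Literature.Barriers.AtomisticToContinuum.

History (route lifecycle, newest last):
- 2026-08-15T13:42:57Z · CLOSED retired — not-a-thesis: assembly does not conclude the sub-problem Statement (operator:999:1257524)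

sub-problem: Crystallization · status: closed(retired) · opened planner-plancard-AtomisticToContinuum-Crystal-9f10d64b-0 2026-08-15T11:28:56Z · rev 0 · ledger route-AtomisticToContinuum-GscLoopSurgery
GENERATED by the gate from the ledger (D-0016/17). Provers cite these decls: `theorem foo : Summit.AtomisticToContinuum.Crystallization.Theses.GscLoopSurgery.<Decl> := …` in Summits/AtomisticToContinuum/Crystallization/Theorems/<Name>.lean.
-/

namespace Summit.AtomisticToContinuum.Crystallization.Theses.GscLoopSurgery

open scoped BigOperators Topology Manifold Classical MeasureTheory ProbabilityTheory Matrix InnerProductSpace ComplexConjugate ContinuousMap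
open Filter Set Function TopologicalSpace MeasureTheory

attribute [summit_statement] _root_.Crystallization

/-- item stmt-AtomisticToContinuum-2911 · target · rank 0 · open · by planner
why it might fail: Needs one Q charged with density ρ(R,ε) at every scale for infinitely many N: fails if LJ bulk minimisers are aperiodically stacked (domination fails), if lattice parameters of bulk windows do not accumulate (excluded by compactness of B), or if ground states are foams (NoFoam false).
sources: BlancLewin2015, FlatleyTheil2015, Radin1991, Suto2011
[crux] (finite-N hinge; deterministic shadow of "the Benjamini–Schramm limit of the ground states
charges Q") for every sequence of LJ ground states x^N in ℝ³ there is ONE periodic configuration Q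
such that for all R, ε > 0 there is ρ > 0 with, for infinitely many N, at least ρN particles i whose
R-neighbourhood x^N ∩ B_R(x_i) is ε-matched both ways with x_i + A(Q.points − q) for some linear
isometry A and some base point q ∈ Q.points (base point in Q.points, not a fixed origin: no
vertex-transitivity is forced, cf. refuter note on 0751). Weaker than BulkDefectVanish 0751
(fraction → 1, fixed HCP): positive density, frequently in N, any periodic Q. [deps:
StationaryMinimisersChargePeriodic, NoFoam] [difficulty: XL] -/
@[route_item "route-AtomisticToContinuum-GscLoopSurgery"]
def GroundStatesChargePeriodic : Prop :=
  ∀ x : (N : ℕ) → (Fin N → EuclideanSpace ℝ (Fin 3)), (∀ N, Literature.MathematicalPhysics.StatisticalMechanics.IsGroundState Literature.MathematicalPhysics.StatisticalMechanics.lennardJones (x N)) → ∃ Q : Literature.MathematicalPhysics.StatisticalMechanics.PeriodicConfiguration 3, ∀ R ε : ℝ, 0 < R → 0 < ε → ∃ ρ : ℝ, 0 < ρ ∧ ∃ᶠ N : ℕ in Filter.atTop, ρ * (N : ℝ) ≤ (Nat.card {i : Fin N // ∃ A : EuclideanSpace ℝ (Fin 3) →ₗᵢ[ℝ] EuclideanSpace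 ℝ (Fin 3), ∃ q ∈ Q.points, (∀ s ∈ Q.points, dist s q ≤ R → ∃ j : Fin N, dist (x N j) (x N i + A (s - q)) ≤ ε) ∧ (∀ j : Fin N, dist (x N j) (x N i) ≤ R → ∃ s ∈ Q.points, dist (x N j) (x N i + A (s - q)) ≤ ε)} : ℝ)

/-- item stmt-AtomisticToContinuum-4190 · crux · rank 2 · closed · moot by None · by planner
why it might fail: Carries the LJ local physics at infinite volume: fails if some r₀-dense local limit is amorphous/polytetrahedral (FlexibleKissingArrangements, TetrahedralFrustration) or has strain/defects at EVERY scale that no compact particle-conserving surgery cheapens; B and η₀ = 1e−3 must fit the relaxed bulk.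
sources: Hales2012, BlancLewin2015, FlatleyTheil2015, Suto2011, BellissardRadinShlosman2010, CaiNix2016
[crux S — the LJ local physics at infinite volume; card items N1 + anti-foam + bounded cores, folded
into one existence statement] Let 𝔏 be the class of LOCAL LIMITS X ⊆ ℝ³ of translated LJ
ground-state sequences (typed inline: ∃ ground states x^N, indices σ ↑, translations τ_j with
two-way ε-matching of x^(σ j) + τ_j and X on every ball ‖·‖ ≤ R, eventually in j, for all R and ε >
0), and call X a hard-core GSC if no rearrangement of finitely many of its points into distinct new
positions avoiding the other points lowers interactionEnergy + interaction with the rest (typed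
inline; hypothesis here, discharged by support LocalLimitStable). CLAIM: if X ∈ 𝔏 is a hard-core GSC
and r₀-relatively dense (every closed r₀-ball meets X), then for every R > 0 there are a point c ∈
X, a linear isometry A, a translation v, parameters (a,h) in the box B = {47/50 ≤ a ≤ 1, 39/50·a ≤ h
≤ 17/20·a} and a Hägg word s (IsHaggSeq) such that X and A(barlowStacking a h s) + v are
(1/1000)-matched both ways on the closed ball B(c,R). I.e. every bulk local limit contains, at every
scale, an essentially PERFECT uniformly layered close-packed window (any stacking word; η₀ = 1/1000
leaves room for ≲ 10² relaxed -/
@[route_item "route-AtomisticToContinuum-GscLoopSurgery"]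
def LayeredWindows : Prop :=
  ∀ X : Set (EuclideanSpace ℝ (Fin 3)), (∃ (x : (N : ℕ) → (Fin N → EuclideanSpace ℝ (Fin 3))) (σ : ℕ → ℕ) (τ : ℕ → EuclideanSpace ℝ (Fin 3)), (∀ N, Literature.MathematicalPhysics.StatisticalMechanics.IsGroundState Literature.MathematicalPhysics.StatisticalMechanics.lennardJones (x N)) ∧ StrictMono σ ∧ ∀ R ε : ℝ, 0 < ε → ∀ᶠ j : ℕ in Filter.atTop, (∀ p ∈ X, ‖p‖ ≤ R → ∃ i : Fin (σ j), dist (x (σ j) i + τ j) p ≤ ε) ∧ (∀ i : Fin (σ j), ‖x (σ j) i + τ j‖ ≤ R → ∃ p ∈ X, dist (x (σ j) i + τ j) p ≤ ε)) → (∀ (n : ℕ) (y z : Fin n → EuclideanSpace ℝ (Fin 3)), Function.Injective y → Function.Injective z → Set.range y ⊆ X → Disjoint (Set.range z) (X \ Set.range y) → Literature.MathematicalPhysics.StatisticalMechanics.interactionEnergy Literature.MathematicalPhysics.StatisticalMechanics.lennardJones y + ∑ i, ∑' q : ↥(X \ Set.range y), Literature.MathematicalPhysics.StatisticalMechanics.lennardJones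 (dist (y i) (q : EuclideanSpace ℝ (Fin 3))) ≤ Literature.MathematicalPhysics.StatisticalMechanics.interactionEnergy Literature.MathematicalPhysics.StatisticalMechanics.lennardJones z + ∑ i, ∑' q : ↥(X \ Set.range y), Literature.MathematicalPhysics.StatisticalMechanics.lennardJones (dist (z i) (q : EuclideanSpace ℝ (Fin 3)))) → ∀ r₀ : ℝ, 0 < r₀ → (∀ c : EuclideanSpace ℝ (Fin 3), ∃ q ∈ X, dist q c ≤ r₀) → ∀ R : ℝ, 0 < R → ∃ c ∈ X, ∃ (A : EuclideanSpace ℝ (Fin 3) ≃ₗᵢ[ℝ] EuclideanSpace ℝ (Fin 3)) (v : EuclideanSpace ℝ (Fin 3)) (a h : ℝ) (s : ℤ → ℤ), (47 / 50 ≤ a ∧ a ≤ 1 ∧ 39 / 50 * a ≤ h ∧ h ≤ 17 / 20 * a) ∧ Literature.MathematicalPhysics.StatisticalMechanics.IsHaggSeq s ∧ ((∀ p ∈ ((fun p => A p + v) '' Literature.MathematicalPhysics.StatisticalMechanics.barlowStacking a h s), dist p c ≤ R → ∃ q ∈ X, dist q p ≤ 1 / 1000) ∧ (∀ q ∈ X,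 dist q c ≤ R → ∃ p ∈ ((fun p => A p + v) '' Literature.MathematicalPhysics.StatisticalMechanics.barlowStacking a h s), dist q p ≤ 1 / 1000))

/-- item stmt-AtomisticToContinuum-4191 · crux · rank 3 · closed · moot by None · by planner
why it might fail: Bookkeeping: gain ≈ 2(|J₂|−Σ(k−1)|J_k|)πL²/cell (~4e−4 L²) vs cost C·D·L + ⟨force residual, δ⟩ + O(V″η₀²·D·L²) for δ = X − stacking: needs equilibrium smoothness of δ once D ≳ 20; dies if wall pairs bind beyond Hägg domination or loop cores are not O(1) per atom.
sources: Dobrushin1973, CaiNix2016, GiulianiTheil2021, HudsonOrtner2014, BellissardRadinShlosman2010, RadinSchulman1983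
[crux L — the card's mechanism: the critical Shockley-loop radius as a variational test of an
infinite-volume ground state] For (a,h) ∈ B with Hägg domination at (a,h) in the exact form
delivered by LjRegistryDomination (Σ k|J_k| < ∞, J₂ < 0, Σ_{k≥3}(k−1)|J_k| ≤ |J₂|/2, J_k =
barlowCoupling lennardJones a h k), a Hägg word s, and X ∈ 𝔏 a hard-core GSC that is GLOBALLY
(1/1000)-matched both ways with the exact uniform stacking barlowStacking a h s (axis-aligned,
untranslated — WLOG by isometry invariance of 𝔏, handled in the glue): the set of walls {m : ℤ |
s(m+1) = s(m)} (deviations from the hcp pattern ABAB) has at most one element. Proof idea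
(Dobrushin's two-wall argument with dislocation loops as the cylinder): with two walls at layer
distance D, the slab between them reads e.g. …ACAC… against the hcp continuation …ABAB…; translating
every other layer of the slab by one Shockley partial (−w, |w| = a/√3) inside a disc of radius L —
i.e. ⌈D/2⌉ coaxial partial-loop DIPOLES (zero net Burgers vector per shifted layer) — removes both
walls inside the disc: gain ≥ 2(|J₂| − Σ_{k≥3}(k−1)|J_k|)·(πL²/cell area) ≥ |J₂|·πL²/cell, cost ≤
C·D·L (loop cores + dipole interactions, no log for di -/
@[route_item "route-AtomisticToContinuum-GscLoopSurgery"]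
def TwinLoopLemma : Prop :=
  ∀ (a h : ℝ) (s : ℤ → ℤ) (X : Set (EuclideanSpace ℝ (Fin 3))), (47 / 50 ≤ a ∧ a ≤ 1 ∧ 39 / 50 * a ≤ h ∧ h ≤ 17 / 20 * a) → Literature.MathematicalPhysics.StatisticalMechanics.IsHaggSeq s → (Summable (fun k : ℕ => (k : ℝ) * |Literature.MathematicalPhysics.StatisticalMechanics.barlowCoupling Literature.MathematicalPhysics.StatisticalMechanics.lennardJones a h k|) ∧ Literature.MathematicalPhysics.StatisticalMechanics.barlowCoupling Literature.MathematicalPhysics.StatisticalMechanics.lennardJones a h 2 < 0 ∧ ∑' k : ℕ, (if 3 ≤ k then ((k : ℝ) - 1) * |Literature.MathematicalPhysics.StatisticalMechanics.barlowCoupling Literature.MathematicalPhysics.StatisticalMechanics.lennardJones a h k| else 0) ≤ (1 / 2) * |Literature.MathematicalPhysics.StatisticalMechanics.barlowCoupling Literature.MathematicalPhysics.StatisticalMechanics.lennardJones a h 2|) → (∃ (x : (N : ℕ) → (Fin N → EuclideanSpace ℝ (Fin 3))) (σ : ℕ → ℕ) (τ : ℕ → EuclideanSpace ℝ (Fin 3)),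 (∀ N, Literature.MathematicalPhysics.StatisticalMechanics.IsGroundState Literature.MathematicalPhysics.StatisticalMechanics.lennardJones (x N)) ∧ StrictMono σ ∧ ∀ R ε : ℝ, 0 < ε → ∀ᶠ j : ℕ in Filter.atTop, (∀ p ∈ X, ‖p‖ ≤ R → ∃ i : Fin (σ j), dist (x (σ j) i + τ j) p ≤ ε) ∧ (∀ i : Fin (σ j), ‖x (σ j) i + τ j‖ ≤ R → ∃ p ∈ X, dist (x (σ j) i + τ j) p ≤ ε)) → (∀ (n : ℕ) (y z : Fin n → EuclideanSpace ℝ (Fin 3)), Function.Injective y → Function.Injective z → Set.range y ⊆ X → Disjoint (Set.range z) (X \ Set.range y) → Literature.MathematicalPhysics.StatisticalMechanics.interactionEnergy Literature.MathematicalPhysics.StatisticalMechanics.lennardJones y + ∑ i, ∑' q : ↥(X \ Set.range y), Literature.MathematicalPhysics.StatisticalMechanics.lennardJones (dist (y i) (q : EuclideanSpace ℝ (Fin 3))) ≤ Literature.MathematicalPhysics.StatisticalMechanics.interactionEnergy Literature.MathematicalPhysics.StatisticalMechanics.lennardJones z + ∑ i, ∑' q : ↥(X \ Set.range y), Literature.MathematicalPhysics.StatisticalMechanics.lennardJones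 (dist (z i) (q : EuclideanSpace ℝ (Fin 3)))) → ((∀ p ∈ Literature.MathematicalPhysics.StatisticalMechanics.barlowStacking a h s, ∃ q ∈ X, dist q p ≤ 1 / 1000) ∧ (∀ q ∈ X, ∃ p ∈ Literature.MathematicalPhysics.StatisticalMechanics.barlowStacking a h s, dist q p ≤ 1 / 1000)) → Set.Subsingleton {m : ℤ | s (m + 1) = s m}

/-- item stmt-AtomisticToContinuum-4192 · crux · rank 4 · closed · moot by None · by planner
why it might fail: Atomistic Liouville theorem, unproved beyond perturbative far-field results (EOS2016: local uniqueness): fails if LJ-hcp admits bounded non-constant equilibrium displacement fields in the 1e−3 tube (frozen breather-like modes) or is phonon-unstable on part of B; vacuous if relaxed hcp ∉ 𝔏.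
sources: EhrlacherOrtnerShapeev2016, HudsonOrtner2014, doi:10.1007/s00205-016-1019-6, BlancLewin2015, Stillinger2001
[crux P — atomistic Liouville rigidity of the hcp ground state configuration] For (a,h) ∈ B and X ∈
𝔏 a hard-core GSC that is GLOBALLY (1/1000)-matched both ways with the exact hcpStacking a h: X is a
translate of hcpStacking a h (∃ v, X = hcpStacking a h + v). Two-way matching with η₀ < a/4 already
excludes vacancies, interstitials, dislocations, walls, rotations and changes of lattice parameter
(all unbounded or unmatched), so the content is: a bounded (≤ 1e−3) displacement field u on the
perfect crystal which is locally energy-minimising under compact rearrangements is constant — the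
nonlinear discrete analogue of Liouville's theorem for the Navier equations of linear elasticity
(bounded entire solutions are constant); discrete gradients are automatically ≤ 2η₀, so the problem
is perturbative: linearised lattice Liouville (Fourier side: the dynamical matrix of hcp-LJ is
positive definite off k = 0, phonon stability at (a,h)) + a fixed-point/uniqueness argument in
weighted spaces as in the far-field analysis of HudsonOrtner2014 / EhrlacherOrtnerShapeev2016. Used
in the glue to upgrade 'η₀-close to hcp on all of ℝ³' (output of LayeredWindows + TwinLoopLemma
after zooming away from -/
@[route_item "route-AtomisticToContinuum-GscLoopSurgery"]
def HcpLiouvilleRigidity : Prop :=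
  ∀ (a h : ℝ) (X : Set (EuclideanSpace ℝ (Fin 3))), (47 / 50 ≤ a ∧ a ≤ 1 ∧ 39 / 50 * a ≤ h ∧ h ≤ 17 / 20 * a) → (∃ (x : (N : ℕ) → (Fin N → EuclideanSpace ℝ (Fin 3))) (σ : ℕ → ℕ) (τ : ℕ → EuclideanSpace ℝ (Fin 3)), (∀ N, Literature.MathematicalPhysics.StatisticalMechanics.IsGroundState Literature.MathematicalPhysics.StatisticalMechanics.lennardJones (x N)) ∧ StrictMono σ ∧ ∀ R ε : ℝ, 0 < ε → ∀ᶠ j : ℕ in Filter.atTop, (∀ p ∈ X, ‖p‖ ≤ R → ∃ i : Fin (σ j), dist (x (σ j) i + τ j) p ≤ ε) ∧ (∀ i : Fin (σ j), ‖x (σ j) i + τ j‖ ≤ R → ∃ p ∈ X, dist (x (σ j) i + τ j) p ≤ ε)) → (∀ (n : ℕ) (y z : Fin n → EuclideanSpace ℝ (Fin 3)), Function.Injective y → Function.Injective z → Set.range y ⊆ X → Disjoint (Set.range z) (X \ Set.range y) → Literature.MathematicalPhysics.StatisticalMechanics.interactionEnergy Literature.MathematicalPhysics.StatisticalMechanics.lennardJones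 y + ∑ i, ∑' q : ↥(X \ Set.range y), Literature.MathematicalPhysics.StatisticalMechanics.lennardJones (dist (y i) (q : EuclideanSpace ℝ (Fin 3))) ≤ Literature.MathematicalPhysics.StatisticalMechanics.interactionEnergy Literature.MathematicalPhysics.StatisticalMechanics.lennardJones z + ∑ i, ∑' q : ↥(X \ Set.range y), Literature.MathematicalPhysics.StatisticalMechanics.lennardJones (dist (z i) (q : EuclideanSpace ℝ (Fin 3)))) → ((∀ p ∈ Literature.MathematicalPhysics.StatisticalMechanics.hcpStacking a h, ∃ q ∈ X, dist q p ≤ 1 / 1000) ∧ (∀ q ∈ X, ∃ p ∈ Literature.MathematicalPhysics.StatisticalMechanics.hcpStacking a h, dist q p ≤ 1 / 1000)) → ∃ v : EuclideanSpace ℝ (Fin 3), X = (fun p => p + v) '' Literature.MathematicalPhysics.StatisticalMechanics.hcpStacking a h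

/-- item stmt-AtomisticToContinuum-3063 · crux · rank 5 · closed · proved by Summit.AtomisticToContinuum.Crystallization.Theorems.PricedHcpWindowsLjRegistry.stub_ljRegistryDomination @ 3c3336003a98 (prover) · by planner
why it might fail: Certified computation not yet done (Mathlib lacks Bessel K_ν; fallback: interval lattice sums with an r⁻⁶ tail bound): false only if J₂ ≥ 0 or the k ≥ 3 tail is mis-bounded somewhere on B — uncertified margin ≈ 287.
sources: PartayOrtnerCsanyi2017, Stillinger2001, FlatleyTheil2015, BlancLewin2015
[crux] (D) SIGN + HÄGG DOMINATION ON THE BOX (card items (1)-(2), the engine's deliverable): for all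
(a,h) ∈ B, with J_k = barlowCoupling lennardJones a h k: Σ k|J_k| < ∞, J₂ < 0, and Σ_{k≥3}
(k−1)|J_k| ≤ |J₂|/2. Numerics (ours, Bessel series cross-checked by direct sums): worst ratio
|J₂|/Σ_{k≥3}(k−1)|J_k| = 286.9 at (a,h/a) = (0.94,0.78), 428 at the HCP optimum, max J₂ = −3.68e−5
at (1,0.85). Proof route: 2-D Poisson summation ⇒ J_k = (1/covol) Σ_{ξ∈Λ*∖0} φ̂_{kh}(ξ)(1 − cos
2πξ·w) with φ̂_c(ξ) = (1/12)F₆ − (1/6)F₃, F_s(c,ξ) = (2π^s/Γ(s))(ξ/c)^{s−1}K_{s−1}(2πcξ); monotone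
bounds K_ν(z) ≤ √(π/2z)e^{−z}(1 + (4ν²−1)/8z + …) and a certified sign of the one-dimensional
combination at ξ₁ (Mathlib-friendlier fallback: Abel transform + Paley–Wiener contour shift, or
direct interval lattice sums with an r⁻⁶ tail bound). This typed statement supersedes the informal
certified-computation items 0628/0670 and is exactly the hypothesis of HaggDominationAllRanges
(0737). [difficulty: L] -/
@[route_item "route-AtomisticToContinuum-GscLoopSurgery"]
def LjRegistryDomination : Prop :=
  ∀ a h : ℝ, 47 / 50 ≤ a → a ≤ 1 → 39 / 50 * a ≤ h → h ≤ 17 / 20 * a → Summable (fun k : ℕ => (k : ℝ) * |Literature.MathematicalPhysics.StatisticalMechanics.barlowCoupling Literature.MathematicalPhysics.StatisticalMechanics.lennardJones a h k|) ∧ Literature.MathematicalPhysics.StatisticalMechanics.barlowCoupling Literature.MathematicalPhysics.StatisticalMechanics.lennardJones a h 2 < 0 ∧ ∑' k : ℕ, (if 3 ≤ k then ((k : ℝ) - 1) * |Literature.MathematicalPhysics.StatisticalMechanics.barlowCoupling Literature.MathematicalPhysics.StatisticalMechanics.lennardJones a h k| else 0) ≤ (1 / 2) * |Literature.MathematicalPhysics.StatisticalMechanics.barlowCoupling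 Literature.MathematicalPhysics.StatisticalMechanics.lennardJones a h 2|

/-- `LjRegistryDomination` holds: proved by `Summit.AtomisticToContinuum.Crystallization.Theorems.PricedHcpWindowsLjRegistry.stub_ljRegistryDomination` @ 3c3336003a98. -/
theorem LjRegistryDomination_holds : LjRegistryDomination := _root_.Summit.AtomisticToContinuum.Crystallization.Theorems.PricedHcpWindowsLjRegistry.stub_ljRegistryDomination

/-- item stmt-AtomisticToContinuum-2912 · crux · rank 6 · closed · moot by None · by planner
why it might fail: Cohesion of LJ ground states is unproved beyond the minimal distance (BlancLewin2015 §2.2; not even diam = O(N^(1/3)) is in print): sponge-like minimisers with a positive density of r₀-voids would break it and leave this route's GSC statements true but unanchored at finite N.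
sources: BlancLewin2015, Blanc2004, Xue1997
[crux] (card item A1, cohesion) there is r₀ > 0 such that for every R > 0 and every sequence of LJ
ground states x^N, the fraction of particles i for which some point c with |c − x_i| ≤ R has no
particle within distance r₀ tends to 0 as N → ∞. Equivalently every Benjamini–Schramm limit is a.s.
r₀-relatively dense (bounded Voronoi cells), hence the Palm law of a stationary process with
intensity ≥ 1/|B_(r₀)| — the one finite-N input of the line. Mechanism available: exchange of the
least-bound particle (site energy h_max) with a wall position of an interior void (site energy ≤
−k/12 for k contacts), plus deformation (closing a crack gains tail energy ∝ area). [difficulty: L] -/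
@[route_item "route-AtomisticToContinuum-GscLoopSurgery"]
def NoFoam : Prop :=
  ∃ r₀ : ℝ, 0 < r₀ ∧ ∀ R : ℝ, 0 < R → ∀ x : (N : ℕ) → (Fin N → EuclideanSpace ℝ (Fin 3)), (∀ N, Literature.MathematicalPhysics.StatisticalMechanics.IsGroundState Literature.MathematicalPhysics.StatisticalMechanics.lennardJones (x N)) → Filter.Tendsto (fun N : ℕ => (Nat.card {i : Fin N // ∃ c : EuclideanSpace ℝ (Fin 3), dist c (x N i) ≤ R ∧ ∀ j : Fin N, r₀ ≤ dist c (x N j)} : ℝ) / N) Filter.atTop (nhds 0)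

/-- item stmt-AtomisticToContinuum-4193 · support · rank 8 · closed · moot by None · by planner
sources: Suto2011, BellissardRadinShlosman2010, Radin1987, GardnerRadin1979, BlancLewin2015
[support C0 — enabling lemma, PROVE FIRST; Radin/BRS existence of ground state configurations,
hard-core canonical form of Suto2011 §7 Def. 4] Every local limit X ∈ 𝔏 of translated LJ ground
states is a hard-core GSC: for finitely many points y₁..y_n of X and any n DISTINCT new positions
z₁..z_n avoiding X ∖ {y}, interactionEnergy(y) + Σ_i Σ'_{q ∈ X∖y} V(|y_i − q|) ≤ the same for z.
Proof: transplant the rearrangement to x^(σ j) + τ_j for j large (matching radius ≫ diam(y ∪ z),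
tolerance ε → 0): injectivity of the competitor from the minimal distance
(LennardJonesMinimalDistance_holds) and dist(z, X∖y) > 0; near part by continuity of V off 0; far
tails uniformly O(R⁻³) by δ-separation and |V| ≤ Cr⁻⁶; contradiction with
groundStateEnergy_lennardJones_le. Also yields: X is δ-separated and closed. (Suto.IsGSC of the
barrier file is deliberately NOT used: with lennardJones 0 = 0 and coincident competitors allowed it
is false for every configuration of negative energy.) -/
@[route_item "route-AtomisticToContinuum-GscLoopSurgery"]
def LocalLimitStable : Prop :=
  ∀ X : Set (EuclideanSpace ℝ (Fin 3)), (∃ (x : (N : ℕ) → (Fin N → EuclideanSpace ℝ (Fin 3))) (σ : ℕ → ℕ) (τ : ℕ → EuclideanSpace ℝ (Fin 3)), (∀ N, Literature.MathematicalPhysics.StatisticalMechanics.IsGroundState Literature.MathematicalPhysics.StatisticalMechanics.lennardJones (x N)) ∧ StrictMono σ ∧ ∀ R ε : ℝ, 0 < ε → ∀ᶠ j : ℕ in Filter.atTop, (∀ p ∈ X, ‖p‖ ≤ R → ∃ i : Fin (σ j), dist (x (σ j) i + τ j) p ≤ ε) ∧ (∀ i : Fin (σ j), ‖x (σ j) i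 + τ j‖ ≤ R → ∃ p ∈ X, dist (x (σ j) i + τ j) p ≤ ε)) → (∀ (n : ℕ) (y z : Fin n → EuclideanSpace ℝ (Fin 3)), Function.Injective y → Function.Injective z → Set.range y ⊆ X → Disjoint (Set.range z) (X \ Set.range y) → Literature.MathematicalPhysics.StatisticalMechanics.interactionEnergy Literature.MathematicalPhysics.StatisticalMechanics.lennardJones y + ∑ i, ∑' q : ↥(X \ Set.range y), Literature.MathematicalPhysics.StatisticalMechanics.lennardJones (dist (y i) (q : EuclideanSpace ℝ (Fin 3))) ≤ Literature.MathematicalPhysics.StatisticalMechanics.interactionEnergy Literature.MathematicalPhysics.StatisticalMechanics.lennardJones z + ∑ i, ∑' q : ↥(X \ Set.range y), Literature.MathematicalPhysics.StatisticalMechanics.lennardJones (dist (z i) (q : EuclideanSpace ℝ (Fin 3))))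

/-- item stmt-AtomisticToContinuum-2913 · support · rank 9 · closed · proved by Summit.AtomisticToContinuum.Crystallization.Theorems.chargedPeriodicIsOptimal_proof (prover) · by planner
sources: BlancLewin2015
[support] (card item A3, SURGERY-ATTAINMENT; conjunct (i) from a support statement) if a periodic
configuration Q is charged by some sequence of LJ ground states with positive density at every scale
(the conclusion of GroundStatesChargePeriodic for this Q), then e(Q) is the least value of the
energy per particle over all periodic configurations. Proof sketch: if e(Q') < e(Q), pick R ≫
1/(e(Q) − e(Q')) and ε small; along the infinitely many N with ≥ ρN good particles select ≥ ρN/(C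
R³) disjoint good R-balls (hard-core packing bound, in tree), excise each patch (n ≈ |Q ∩ B_R|
particles, self-energy ≥ n e(Q) − Cεn − CR², cross terms ≥ −CR² by the r⁻⁶ tail and
LennardJonesMinimalDistance) and insert a Q'-patch of radius R − 1 with n' ≤ n particles (margin 1 ⇒
all new cross terms ≤ 0); compare E(N') ≤ E_mod with E(M)/M → e_∞ (BlancLewin2015_8_holds, proved)
and e_∞ ≤ e(Q') (trial states, 0629): 0 ≤ k[(n' − n)(e(Q') − e_∞) − n(e(Q) − e(Q')) + CR² + Cεn] +
o(N) with k ≥ cρN/R³ is absurd for R large. No Wulff shapes, no rates. [difficulty: M] -/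
@[route_item "route-AtomisticToContinuum-GscLoopSurgery"]
def ChargedPeriodicIsOptimal : Prop :=
  ∀ Q : Literature.MathematicalPhysics.StatisticalMechanics.PeriodicConfiguration 3, (∃ x : (N : ℕ) → (Fin N → EuclideanSpace ℝ (Fin 3)), (∀ N, Literature.MathematicalPhysics.StatisticalMechanics.IsGroundState Literature.MathematicalPhysics.StatisticalMechanics.lennardJones (x N)) ∧ ∀ R ε : ℝ, 0 < R → 0 < ε → ∃ ρ : ℝ, 0 < ρ ∧ ∃ᶠ N : ℕ in Filter.atTop, ρ * (N : ℝ) ≤ (Nat.card {i : Fin N // ∃ A : EuclideanSpace ℝ (Fin 3) →ₗᵢ[ℝ] EuclideanSpace ℝ (Fin 3), ∃ q ∈ Q.points, (∀ s ∈ Q.points, dist s q ≤ R → ∃ j : Fin N, dist (x N j) (x N i + A (s - q)) ≤ ε) ∧ (∀ j : Fin N, dist (x N j) (x N i) ≤ R → ∃ s ∈ Q.points, dist (x N j) (x N i + A (s - q)) ≤ ε)} : ℝ)) → IsLeast (Set.range fun Q' : Literature.MathematicalPhysics.StatisticalMechanics.PeriodicConfiguration 3 => Q'.energyPerParticle Literature.MathematicalPhysics.StatisticalMechanics.lennardJones)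 (Q.energyPerParticle Literature.MathematicalPhysics.StatisticalMechanics.lennardJones)

/-- `ChargedPeriodicIsOptimal` holds: proved by `Summit.AtomisticToContinuum.Crystallization.Theorems.chargedPeriodicIsOptimal_proof`. -/
theorem ChargedPeriodicIsOptimal_holds : ChargedPeriodicIsOptimal := _root_.Summit.AtomisticToContinuum.Crystallization.Theorems.chargedPeriodicIsOptimal_proof

/-- item stmt-AtomisticToContinuum-2916 · support · rank 9 · closed · proved by Summit.AtomisticToContinuum.Crystallization.Theorems.chargedPatternCrystallizes_proof (prover) · by planner
sources: BlancLewin2015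
[support] (soft) GroundStatesChargePeriodic → LennardJonesMinimalDistance → IsCrystallizing
lennardJones 3: choose scales (k, 1/k), indices N_k ↑ with a good particle i_k, isometries A_k → A
along a subsequence (compactness of O(3)), τ_k := −x_(i_k) + alignment; the two-way matching with
minimal distance is eventually exact near every compact set, so
PeriodicConfiguration.tendsto_sum_of_eventually_near' (in tree) gives local convergence to the
periodic configuration A(Q − q) (isometryImage/translate in CrystallizationSymmetries), multiplicity
1. [difficulty: M] -/
@[route_item "route-AtomisticToContinuum-GscLoopSurgery"]
def ChargedPatternCrystallizes : Prop :=
  GroundStatesChargePeriodic → Literature.MathematicalPhysics.StatisticalMechanics.LennardJonesMinimalDistance → Literature.MathematicalPhysics.StatisticalMechanics.IsCrystallizing Literature.MathematicalPhysics.StatisticalMechanics.lennardJones 3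

/-- `ChargedPatternCrystallizes` holds: proved by `Summit.AtomisticToContinuum.Crystallization.Theorems.chargedPatternCrystallizes_proof`. -/
theorem ChargedPatternCrystallizes_holds : ChargedPatternCrystallizes := _root_.Summit.AtomisticToContinuum.Crystallization.Theorems.chargedPatternCrystallizes_proof

/-- item stmt-AtomisticToContinuum-4194 · support · rank 9 · closed · moot by None · by planner
sources: BlancLewin2015, Suto2011, Hales2012
[support — the glue of this route's mechanism, soft but long: LocalLimitStable → LayeredWindows →
TwinLoopLemma → HcpLiouvilleRigidity → LjRegistryDomination → NoFoam → GroundStatesChargePeriodic]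
Step 0 (bookkeeping on 𝔏): 𝔏 is invariant under isometries (isGroundState_comp_isometry_iff) and
translations and closed under local (two-way-matching) limits (diagonal over the defining
sequences); every sequence of translated δ-separated configurations has a locally convergent
subsequence (Hausdorff compactness on balls); translating barlowStacking a h s by −(haggLabel s k·w
+ k h e₃) + in-layer lattice vectors gives barlowStacking a h (s shifted by k), so re-centred
windows keep an axis-aligned untranslated reference. Step 1 (uniform GSC claim, by contradiction +
compactness): ∀ R ε ∃ L: every r₀-dense X ∈ 𝔏 has within distance L of every point a particle whose
R-window is ε-matched with an isometric copy of hcpStacking a h, (a,h) ∈ B. Else limits X_n → X with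
no window of strict tolerance < ε (a property preserved by isometries, translations and local
limits); LayeredWindows gives (1/1000)-layered windows of all sizes in X; re-centre and pass to the
limit (B compact, {±1}^ℤ compact): -/
@[route_item "route-AtomisticToContinuum-GscLoopSurgery"]
def GscHingeGlue : Prop :=
  LocalLimitStable → LayeredWindows → TwinLoopLemma → HcpLiouvilleRigidity → LjRegistryDomination → NoFoam → GroundStatesChargePeriodic

-- TODO item stmt-AtomisticToContinuum-4195 · assembly · rank 1 · closed · moot by None · by planner — BLOCKED: missing decl(s) CrysEnergyLimit; restate via `ledger route edit` once they land:
--   def Assembly : Prop := GroundStatesChargePeriodic → ChargedPeriodicIsOptimal → ChargedPatternCrystallizes → CrysEnergyLimit → Literature.MathematicalPhysics.StatisticalMechanics.Crystallization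

end Summit.AtomisticToContinuum.Crystallization.Theses.GscLoopSurgery
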